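import Summits.QuantumFields.YangMills.Theorems.UnitScaleTiltFluctuationComparisonRegPrLiftLegsStep
import Summits.QuantumFields.YangMills.Theorems.UnitScaleTiltFluctuationComparisonRegPrLiftFaceRow

/-!
# Route `UnitScaleTilt` — crux K1bR-pr `FluctuationComparisonRegPr` (stmt-QuantumFields-19201 → `…L`), stub `stub_oneStepSmallLift`, piece (L2)
# for INTERIOR-SUPPORTED kernels — the Γ-LEG LAYER, file 5: THE LINE FUNCTIONAL OF A KERNEL LIFT IS THE TABLE'S LINE FORM; `ApproxLiftStep`
# FROM A LINE-NEUTRAL TABLE (support file `--supports stmt-QuantumFields-19201`)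

Cell `ym3-torus` (HUMAN RULING D-0037, YM ladder rung R3), seat `ym3-torus-p1` gen 11 (UV side; cell memo HOME/UV3-NODE.md §20).  Files 1–4
reduced the accuracy clause of `ApproxLiftStep` for `U⋆ = E·faceSec V`, `E` ARBITRARY, to the LINE FUNCTIONAL `rowInLin E c · V(c) + V(c) · rowOutLin E c`
(`approxLiftStep_of_legs`).  Here `E = corrE R kz V` is the fleet's KERNEL CORRECTION (`…LiftFaceKernel`: `ζ(b) = Σ_{o,k} kz(b.dir, offs b₋, o, k) •
Ad log V(∂(o; blockOf b₋ + k − R))`, NO face-support assumed) and the line functional is computed to second order: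

* §1 `walkSum_replicate` (signed sum along a straight forward walk = plain row sum); the in- and out-row bonds of `c` are the bonds of `B(c₋)` at offsets
  `inOff r t = r[μ ↦ r_μ + t]` (`t < L − r_μ`) and of `B(c₊)` at offsets `outOff r t = r[μ ↦ t]` (`t < r_μ`) (`rowInLin_eq_sum`, `rowOutLin_eq_sum`).
* §2 THE LINE FORM of a table: `lineIn R kz a w = L^{-d} Σ_r Σ_{t<L−r_a} Σ_{o,k} kz(a, inOff r t, o, k) • w o (k − R)` and
  `lineOut R kz a w = L^{-d} Σ_r Σ_{t<r_a} Σ_{o,k} kz(a, outOff r t, o, k) • w o (e_a + k − R)` (the far bonds read the NEXT block's plaquettes: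
  shift `e_a`) — i.e. `L^{1-d}·S(ζ)` for the ℤ³-model line average `S` of this lineage's `DualWhitney3D.Sline`; `LineNeutral R kz` := both vanish
  identically (for exit-supported tables = `SNeutral`).
* §3 **`norm_line_corrE_sub_lineForm_le`**: `‖rowInLin E c·V(c) + V(c)·rowOutLin E c − (lineIn + lineOut)(wlogZ V c₋)·V(c)‖ ≤ lineErr·δ²-type bound`
  (exponential linearisation `E − 1 = ζ + O(ζ²)` and ONE transport-unification step `Ad_{V(c)} wlogZ V c₊ o m ≈ wlogZ V c₋ o (e_μ + m)` of layer F5a/F5b).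
* §4 **`approxLiftStep_of_lineNeutral`** (`SU(2)`): `RowMass R kz K₁ ∧ LineNeutral R kz` + the plaquette clause `PlaqSmall (κ₀δ) (kernelLift R kz V)` on
  `δ`-small `V` (`c₀·δ ≤ 1`) ⇒ `ApproxLiftStep P j κ₀ (C·δ²) δ`, `C` explicit in `(d, L, R, K₁)` — the interior-supported twin of the fleet's
  `mdist_avgFun_kernelLift_le` (which needs `FaceSupported ∧ SNeutral`).

Elementary; nothing of Bałaban's is asserted.
-/

noncomputable section

open scoped BigOperators

namespace Summit.QuantumFields.YangMills.Theorems.ApproxLift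

open Literature.MathematicalPhysics.QuantumFieldTheory.Balaban1983to89
open T4Continuum BlockAveraging AveragingRT B10Eq47AxialChi BlockAveragingSection BlockAveragingSectionPlaq
open NormedSpace ExpMeanLog
open scoped Matrix.Norms.L2Operator
open Summit.QuantumFields.YangMills.Theorems.AvgActionDefect (norm_mean_le shiftN_shift_self)
open BlockAveragingEMLLinearised (walkSum walkSum_nil walkSum_cons)

variable {P : Params} {j : ℕ}

/-! ## §1 Rows: signed sums along straight walks; the in- and out-row bonds -/

section Rows

/-- **THE SIGNED SUM ALONG A STRAIGHT FORWARD WALK IS THE PLAIN ROW SUM** `Σ_{t<k} Y(x + t e_μ, μ)`. -/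
theorem walkSum_replicate {W : Type*} [AddCommGroup W] (Y : PBond P j → W) (μ : Fin P.d) :
    ∀ (k : ℕ) (x : Site P j), walkSum Y (walk x (List.replicate k (μ, true))) = ∑ t ∈ Finset.range k, Y ⟨shiftN x μ t, μ⟩
  | 0, x => by simp [walk, walkSum]
  | k + 1, x => by
    rw [List.replicate_succ]
    show walkSum Y (⟨⟨x, μ⟩, true⟩ :: walk (x.shift μ) (List.replicate k (μ, true))) = _
    rw [walkSum_cons, if_pos rfl, walkSum_replicate Y μ k (x.shift μ), Finset.sum_range_succ', add_comm]
    congr 1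
    exact Finset.sum_congr rfl fun t _ => by rw [shiftN_shift_self, ← shiftN_succ]

/-- In-row offsets `r[a ↦ r_a + t]`, `t < L − r_a`. -/
def inOff (r : Fin P.d → Fin P.L) (a : Fin P.d) (t : Fin (P.L - (r a : ℕ))) : Fin P.d → Fin P.L :=
  Function.update r a ⟨(r a : ℕ) + (t : ℕ), by have := t.isLt; omega⟩

/-- Out-row offsets `r[a ↦ t]`, `t < r_a`. -/
def outOff (r : Fin P.d → Fin P.L) (a : Fin P.d) (t : Fin (r a : ℕ)) : Fin P.d → Fin P.L :=
  Function.update r a ⟨(t : ℕ), by have := t.isLt; have := (r a).isLt; omega⟩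

/-- The `t`-th in-row bond from `x_r` is the bond of `B(y)` at offsets `inOff r μ t`. -/
theorem shiftN_blockSite_inOff (y : Site P (j + 1)) (r : Fin P.d → Fin P.L) (μ : Fin P.d) (t : Fin (P.L - (r μ : ℕ))) :
    shiftN (Site.blockSite y r) μ t = Site.blockSite y (inOff r μ t) :=
  shiftN_blockSite y r μ (by have := t.isLt; omega)

/-- The `t`-th out-row bond from the out-base is the bond of `B(c₊)` at offsets `outOff r μ t` (standing range). -/
theorem shiftN_outBase_outOff (hj : j + 1 ≤ P.m + P.K) (c : PBond P (j + 1)) (r : Fin P.d → Fin P.L) (t : Fin (r c.dir : ℕ)) :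
    shiftN (outBase c r) c.dir t = Site.blockSite c.tgt (outOff r c.dir t) := by
  have ht := t.isLt
  have hr := (r c.dir).isLt
  rw [outBase_eq hj, shiftN_blockSite c.tgt _ c.dir (by rw [Function.update_self]; simp only; omega)]
  congr 1
  rw [Function.update_idem]
  unfold outOff
  congr 1
  apply Fin.ext
  simp

variable {n : Type*} [Fintype n] [DecidableEq n] [Nonempty n]

omit [Nonempty n] in
/-- **`rowInLin` AS A PLAIN SUM**: `L^{-d} Σ_r Σ_{t < L − r_μ} (E(blockSite c₋ (inOff r μ t), μ) − 1)`. -/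
theorem rowInLin_eq_sum (E : GaugeField P j (Matrix.specialUnitaryGroup n ℂ)) (c : PBond P (j + 1)) :
    rowInLin E c = (((P.L : ℂ) ^ P.d))⁻¹ • ∑ r : Fin P.d → Fin P.L, ∑ t : Fin (P.L - (r c.dir : ℕ)),
      corrY E ⟨Site.blockSite c.src (inOff r c.dir t), c.dir⟩ := by
  unfold rowInLin
  rw [mean_idx_eq_mean_offsets (fun r : Fin P.d → Fin P.L =>
    walkSum (corrY E) (walk (Site.blockSite c.src r) (List.replicate (P.L - (r c.dir : ℕ)) (c.dir, true))))]
  congr 1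
  refine Finset.sum_congr rfl fun r _ => ?_
  rw [walkSum_replicate, Finset.sum_range]
  exact Finset.sum_congr rfl fun t _ => by rw [shiftN_blockSite_inOff]

omit [Nonempty n] in
/-- **`rowOutLin` AS A PLAIN SUM**: `L^{-d} Σ_r Σ_{t < r_μ} (E(blockSite c₊ (outOff r μ t), μ) − 1)` (standing range). -/
theorem rowOutLin_eq_sum (hj : j + 1 ≤ P.m + P.K) (E : GaugeField P j (Matrix.specialUnitaryGroup n ℂ)) (c : PBond P (j + 1)) :
    rowOutLin E c = (((P.L : ℂ) ^ P.d))⁻¹ • ∑ r : Fin P.d → Fin P.L, ∑ t : Fin (r c.dir : ℕ),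
      corrY E ⟨Site.blockSite c.tgt (outOff r c.dir t), c.dir⟩ := by
  unfold rowOutLin
  rw [mean_idx_eq_mean_offsets (fun r : Fin P.d → Fin P.L =>
    walkSum (corrY E) (walk (outBase c r) (List.replicate (r c.dir : ℕ) (c.dir, true))))]
  congr 1
  refine Finset.sum_congr rfl fun r _ => ?_
  rw [walkSum_replicate, Finset.sum_range]
  exact Finset.sum_congr rfl fun t _ => by rw [shiftN_outBase_outOff hj]

end Rows

/-! ## §2 The line form of a kernel table -/

section LineForm

variable {n : Type*} [Fintype n] [DecidableEq n] [Nonempty n]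
variable (R : ℕ) (kz : Fin P.d → (Fin P.d → Fin P.L) → Orient P.d → (Fin P.d → Fin (2 * R + 1)) → ℝ)

/-- **THE IN-LINE FORM** of the table in direction `a` against an orientation∕displacement-indexed matrix field `w` based at the block:
`L^{-d} Σ_r Σ_{t<L−r_a} Σ_{o,k} kz(a, r[a ↦ r_a+t], o, k) • w(o, k − R)`. -/
def lineIn (a : Fin P.d) (w : Orient P.d → (Fin P.d → ℤ) → Matrix n n ℂ) : Matrix n n ℂ :=
  (((P.L : ℂ) ^ P.d))⁻¹ • ∑ r : Fin P.d → Fin P.L, ∑ t : Fin (P.L - (r a : ℕ)),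
    ∑ o : Orient P.d, ∑ k : Fin P.d → Fin (2 * R + 1), ((kz a (inOff r a t) o k : ℝ) : ℂ) • w o (kvec R k)

/-- **THE OUT-LINE FORM**: `L^{-d} Σ_r Σ_{t<r_a} Σ_{o,k} kz(a, r[a ↦ t], o, k) • w(o, e_a + k − R)` — the far bonds of the rows belong to the NEXT block,
whose table entries read plaquettes displaced by `e_a`. -/
def lineOut (a : Fin P.d) (w : Orient P.d → (Fin P.d → ℤ) → Matrix n n ℂ) : Matrix n n ℂ :=
  (((P.L : ℂ) ^ P.d))⁻¹ • ∑ r : Fin P.d → Fin P.L, ∑ t : Fin (r a : ℕ),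
    ∑ o : Orient P.d, ∑ k : Fin P.d → Fin (2 * R + 1), ((kz a (outOff r a t) o k : ℝ) : ℂ) • w o (bvec true a + kvec R k)

/-- **LINE-NEUTRALITY** of a table (at the matrix size `n`): the line form vanishes on every field `w`, in every direction — the generalised
S-neutrality («the signed line sums of the correction vanish»: this lineage's `Sline ∘ Zop = 0`); for an exit-supported table it is `SNeutral`. -/
def LineNeutral : Prop :=
  ∀ (a : Fin P.d) (w : Orient P.d → (Fin P.d → ℤ) → Matrix n n ℂ), lineIn (n := n) R kz a w + lineOut (n := n) R kz a w = 0

end LineForm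

/-! ## §3 The line functional of the kernel lift to second order -/

section Line

variable {n : Type*} [Fintype n] [DecidableEq n] [Nonempty n]
variable {R : ℕ} {kz : Fin P.d → (Fin P.d → Fin P.L) → Orient P.d → (Fin P.d → Fin (2 * R + 1)) → ℝ}

/-- A special unitary matrix has operator norm `≤ 1`. -/
private theorem norm_coe_su_le_one₆ (g : Matrix.specialUnitaryGroup n ℂ) : ‖(g : Matrix n n ℂ)‖ ≤ 1 :=
  (UnitaryModel.norm_of_mem_unitaryGroup (Matrix.specialUnitaryGroup_le_unitaryGroup g.2)).le

omit [Nonempty n] in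
/-- `Ad_g X · g = g · X`. -/
theorem conjM_mul_coe (g : Matrix.specialUnitaryGroup n ℂ) (X : Matrix n n ℂ) : conjM g X * (g : Matrix n n ℂ) = (g : Matrix n n ℂ) * X := by
  unfold conjM
  rw [mul_assoc, ← Submonoid.coe_mul, inv_mul_cancel]
  show (g : Matrix n n ℂ) * X * 1 = _
  rw [mul_one]

/-- The one-step walk along `c` transports by `V(c)`. -/
theorem holAt_walk_single {G : Type*} [GaugeGroup G] (V : GaugeField P (j + 1) G) (c : PBond P (j + 1)) :
    holAt V (walk c.src [(c.dir, true)]) = V c := by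
  show holAt V [⟨⟨c.src, c.dir⟩, true⟩] = V c
  rw [holAt_cons, holAt_nil, mul_one, if_pos rfl]

/-- Net displacement of the one-letter word `[+e_μ]`. -/
theorem netDisp_single' (μ κ : Fin P.d) : netDisp [(μ, true)] κ = bvec true μ κ := by
  rw [netDisp_cons, netDisp_nil', add_zero]
  unfold bvec
  by_cases h : κ = μ
  · subst h; simp
  · simp [h, Ne.symm h]

/-- `c₊ = c₋ + e_μ` in the `vadd` bookkeeping. -/
theorem vadd_bvec_true (c : PBond P (j + 1)) : vadd c.src (bvec true c.dir) = c.tgt := by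
  rw [vadd_bvec, if_pos rfl]; rfl

omit [Nonempty n] in
/-- A mean over the `L^d` offsets is bounded by the termwise bound. -/
theorem norm_offsetMean_le {f : (Fin P.d → Fin P.L) → Matrix n n ℂ} {t : ℝ} (h : ∀ r, ‖f r‖ ≤ t) (ht : 0 ≤ t) :
    ‖(((P.L : ℂ) ^ P.d))⁻¹ • ∑ r : Fin P.d → Fin P.L, f r‖ ≤ t := by
  have hcard : ((P.L : ℂ) ^ P.d) = (Fintype.card (Fin P.d → Fin P.L) : ℂ) := by
    rw [Fintype.card_fun, Fintype.card_fin, Fintype.card_fin, Nat.cast_pow]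
  rw [hcard]
  exact norm_mean_le h ht

/-- `ζ` at an in-row bond of `c`: the table row at `inOff r μ t` against the transported logarithms of the block `c₋`. -/
theorem zeta_inRow (hj : j + 1 ≤ P.m + P.K) (V : GaugeField P (j + 1) (Matrix.specialUnitaryGroup n ℂ)) (c : PBond P (j + 1))
    (r : Fin P.d → Fin P.L) (t : Fin (P.L - (r c.dir : ℕ))) :
    zeta R kz V ⟨Site.blockSite c.src (inOff r c.dir t), c.dir⟩ =
      ∑ o : Orient P.d, ∑ k : Fin P.d → Fin (2 * R + 1), ((kz c.dir (inOff r c.dir t) o k : ℝ) : ℂ) • wlogZ V c.src o (kvec R k) := by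
  rw [zeta_eq_sum_wlogZ]
  simp only [offs_blockSite hj, Site.blockOf_blockSite hj]

/-- `ζ` at an out-row bond of `c`: the table row at `outOff r μ t` against the transported logarithms of the block `c₊`. -/
theorem zeta_outRow (hj : j + 1 ≤ P.m + P.K) (V : GaugeField P (j + 1) (Matrix.specialUnitaryGroup n ℂ)) (c : PBond P (j + 1))
    (r : Fin P.d → Fin P.L) (t : Fin (r c.dir : ℕ)) :
    zeta R kz V ⟨Site.blockSite c.tgt (outOff r c.dir t), c.dir⟩ =
      ∑ o : Orient P.d, ∑ k : Fin P.d → Fin (2 * R + 1), ((kz c.dir (outOff r c.dir t) o k : ℝ) : ℂ) • wlogZ V c.tgt o (kvec R k) := by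
  rw [zeta_eq_sum_wlogZ]
  simp only [offs_blockSite hj, Site.blockOf_blockSite hj]

/-- THE SECOND-ORDER SIZE of the line functional of a kernel lift: `L·(2(2K₁δ)² + K₁·unifB)`. -/
def lineErr (P : Params) (R : ℕ) (K₁ δ : ℝ) : ℝ := (P.L : ℝ) * (2 * (K₁ * (2 * δ)) ^ 2 + K₁ * unifB P R δ)

variable {K₁ δ : ℝ} {V : GaugeField P (j + 1) (Matrix.specialUnitaryGroup n ℂ)}

/-- `‖E(b) − 1 − ζ(b)‖ ≤ (2K₁δ)²` for the kernel correction on a `δ`-small `V` (`2K₁δ ≤ 1`). -/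
theorem norm_corrY_corrE_sub_zeta_le (hδ0 : 0 ≤ δ) (hV : PlaqSmall δ V) (hδ : δ ≤ 1 / 3) (hπ : Fintype.card n * δ < Real.pi)
    (hK : RowMass R kz K₁) (hs1 : K₁ * (2 * δ) ≤ 1) (b : PBond P j) :
    ‖corrY (corrE R kz V) b - zeta R kz V b‖ ≤ (K₁ * (2 * δ)) ^ 2 := by
  have hζ : ‖zeta R kz V b‖ ≤ K₁ * (2 * δ) := norm_zeta_le hδ0 hV (hδ.trans (by norm_num)) hK b
  have h0 : 0 ≤ K₁ * (2 * δ) := (norm_nonneg _).trans hζ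
  calc _ ≤ ‖zeta R kz V b‖ ^ 2 := norm_coe_corrE_sub_one_sub_zeta_le hV hδ hπ (hζ.trans hs1)
    _ ≤ (K₁ * (2 * δ)) ^ 2 := by gcongr

/-- **THE IN-ROW FUNCTIONAL OF THE KERNEL LIFT IS THE IN-LINE FORM UP TO `L(2K₁δ)²`** (standing range). -/
theorem norm_rowInLin_sub_lineIn_le (hj : j + 1 ≤ P.m + P.K) (hδ0 : 0 ≤ δ) (hV : PlaqSmall δ V) (hδ : δ ≤ 1 / 3)
    (hπ : Fintype.card n * δ < Real.pi) (hK : RowMass R kz K₁) (hs1 : K₁ * (2 * δ) ≤ 1) (c : PBond P (j + 1)) :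
    ‖rowInLin (corrE R kz V) c - lineIn (n := n) R kz c.dir (wlogZ V c.src)‖ ≤ (P.L : ℝ) * (K₁ * (2 * δ)) ^ 2 := by
  rw [rowInLin_eq_sum]
  unfold lineIn
  rw [← smul_sub, ← Finset.sum_sub_distrib]
  refine norm_offsetMean_le (fun r => ?_) (by positivity)
  rw [← Finset.sum_sub_distrib]
  calc _ ≤ ∑ t : Fin (P.L - (r c.dir : ℕ)), (K₁ * (2 * δ)) ^ 2 := by
        refine (norm_sum_le _ _).trans (Finset.sum_le_sum fun t _ => ?_)
        rw [← zeta_inRow hj V c r t]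
        exact norm_corrY_corrE_sub_zeta_le hδ0 hV hδ hπ hK hs1 _
    _ = ((P.L - (r c.dir : ℕ) : ℕ) : ℝ) * (K₁ * (2 * δ)) ^ 2 := by rw [Finset.sum_const, Finset.card_univ, Fintype.card_fin, nsmul_eq_mul]
    _ ≤ (P.L : ℝ) * (K₁ * (2 * δ)) ^ 2 := by gcongr; exact_mod_cast Nat.sub_le _ _

/-- **THE OUT-ROW FUNCTIONAL, TRANSPORTED TO THE FRAME OF `c₋`, IS THE OUT-LINE FORM UP TO `L(2K₁δ)² + L·K₁·unifB`**: `Ad_{V(c)}` carries the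
`c₊`-frame logarithms to `c₋`-frame logarithms displaced by `e_μ` (one unification step per bond; standing range). -/
theorem norm_conjM_rowOutLin_sub_lineOut_le (hj : j + 1 ≤ P.m + P.K) (hδ0 : 0 ≤ δ) (hV : PlaqSmall δ V) (hδ : δ ≤ 1 / 3)
    (hπ : Fintype.card n * δ < Real.pi) (hK : RowMass R kz K₁) (hs1 : K₁ * (2 * δ) ≤ 1) (c : PBond P (j + 1)) :
    ‖conjM (V c) (rowOutLin (corrE R kz V) c) - lineOut (n := n) R kz c.dir (wlogZ V c.src)‖ ≤
      (P.L : ℝ) * (K₁ * (2 * δ)) ^ 2 + (P.L : ℝ) * (K₁ * unifB P R δ) := by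
  have hU0 : 0 ≤ unifB P R δ := by unfold unifB; positivity
  have hK0 : 0 ≤ K₁ := le_trans (Finset.sum_nonneg fun o _ => Finset.sum_nonneg fun k _ => abs_nonneg _) (hK c.dir (fun _ => ⟨0, P.L_pos⟩))
  rw [rowOutLin_eq_sum hj]
  unfold lineOut
  rw [conjM_smul, conjM_sum, ← smul_sub, ← Finset.sum_sub_distrib]
  refine norm_offsetMean_le (fun r => ?_) (by positivity)
  rw [conjM_sum, ← Finset.sum_sub_distrib]
  have hper : ∀ t : Fin (r c.dir : ℕ),
      ‖conjM (V c) (corrY (corrE R kz V) ⟨Site.blockSite c.tgt (outOff r c.dir t), c.dir⟩) -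
          ∑ o : Orient P.d, ∑ k : Fin P.d → Fin (2 * R + 1),
            ((kz c.dir (outOff r c.dir t) o k : ℝ) : ℂ) • wlogZ V c.src o (bvec true c.dir + kvec R k)‖ ≤
        (K₁ * (2 * δ)) ^ 2 + K₁ * unifB P R δ := fun t => by
    -- linearise `E − 1 = ζ + O(ζ²)`, then transport the kernel sum from `c₊` to `c₋`
    have h1 : ‖conjM (V c) (corrY (corrE R kz V) ⟨Site.blockSite c.tgt (outOff r c.dir t), c.dir⟩) -
        conjM (V c) (zeta R kz V ⟨Site.blockSite c.tgt (outOff r c.dir t), c.dir⟩)‖ ≤ (K₁ * (2 * δ)) ^ 2 := by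
      rw [← conjM_sub]
      exact (norm_conjM_le _ _).trans (norm_corrY_corrE_sub_zeta_le hδ0 hV hδ hπ hK hs1 _)
    have h2 : ‖conjM (V c) (zeta R kz V ⟨Site.blockSite c.tgt (outOff r c.dir t), c.dir⟩) -
        ∑ o : Orient P.d, ∑ k : Fin P.d → Fin (2 * R + 1),
          ((kz c.dir (outOff r c.dir t) o k : ℝ) : ℂ) • wlogZ V c.src o (bvec true c.dir + kvec R k)‖ ≤ K₁ * unifB P R δ := by
      rw [zeta_outRow hj, ← vadd_bvec_true c, ← holAt_walk_single V c]
      refine (norm_conjM_kernelSum_sub_le hδ0 hV (hδ.trans (by norm_num)) c.src [(c.dir, true)] (bvec true c.dir)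
        (netDisp_single' c.dir) (by simp) (natAbs_bvec_le _ _) (fun o k => kz c.dir (outOff r c.dir t) o k)).trans ?_
      exact mul_le_mul_of_nonneg_right (hK _ _) hU0
    exact (norm_sub_le_norm_sub_add_norm_sub _ _ _).trans (add_le_add h1 h2)
  calc _ ≤ ∑ t : Fin (r c.dir : ℕ), ((K₁ * (2 * δ)) ^ 2 + K₁ * unifB P R δ) :=
        (norm_sum_le _ _).trans (Finset.sum_le_sum fun t _ => hper t)
    _ = ((r c.dir : ℕ) : ℝ) * ((K₁ * (2 * δ)) ^ 2 + K₁ * unifB P R δ) := by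
        rw [Finset.sum_const, Finset.card_univ, Fintype.card_fin, nsmul_eq_mul]
    _ ≤ (P.L : ℝ) * ((K₁ * (2 * δ)) ^ 2 + K₁ * unifB P R δ) := by
        refine mul_le_mul_of_nonneg_right ?_ (by positivity)
        exact_mod_cast (r c.dir).isLt.le
    _ = _ := by ring

/-- **THE LINE FUNCTIONAL OF THE KERNEL LIFT IS THE TABLE'S LINE FORM TO SECOND ORDER** (standing range; `δ`-small `V`, `δ ≤ 1/3`, `N·δ < π`,
row mass `≤ K₁`, `2K₁δ ≤ 1`): `‖rowInLin E c·V(c) + V(c)·rowOutLin E c − (lineIn + lineOut)(wlogZ V c₋)·V(c)‖ ≤ lineErr P R K₁ δ`. -/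
theorem norm_line_corrE_sub_lineForm_le (hj : j + 1 ≤ P.m + P.K) (hδ0 : 0 ≤ δ) (hV : PlaqSmall δ V) (hδ : δ ≤ 1 / 3)
    (hπ : Fintype.card n * δ < Real.pi) (hK : RowMass R kz K₁) (hs1 : K₁ * (2 * δ) ≤ 1) (c : PBond P (j + 1)) :
    ‖rowInLin (corrE R kz V) c * ((V c : Matrix.specialUnitaryGroup n ℂ) : Matrix n n ℂ) +
          ((V c : Matrix.specialUnitaryGroup n ℂ) : Matrix n n ℂ) * rowOutLin (corrE R kz V) c -
        (lineIn (n := n) R kz c.dir (wlogZ V c.src) + lineOut (n := n) R kz c.dir (wlogZ V c.src)) *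
          ((V c : Matrix.specialUnitaryGroup n ℂ) : Matrix n n ℂ)‖ ≤ lineErr P R K₁ δ := by
  set Vc : Matrix n n ℂ := ((V c : Matrix.specialUnitaryGroup n ℂ) : Matrix n n ℂ) with hVc
  have hin := norm_rowInLin_sub_lineIn_le hj hδ0 hV hδ hπ hK hs1 c
  have hout := norm_conjM_rowOutLin_sub_lineOut_le hj hδ0 hV hδ hπ hK hs1 c
  have e : rowInLin (corrE R kz V) c * Vc + Vc * rowOutLin (corrE R kz V) c -
      (lineIn (n := n) R kz c.dir (wlogZ V c.src) + lineOut (n := n) R kz c.dir (wlogZ V c.src)) * Vc =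
      ((rowInLin (corrE R kz V) c - lineIn (n := n) R kz c.dir (wlogZ V c.src)) +
        (conjM (V c) (rowOutLin (corrE R kz V) c) - lineOut (n := n) R kz c.dir (wlogZ V c.src))) * Vc := by
    rw [hVc, ← conjM_mul_coe (V c) (rowOutLin (corrE R kz V) c)]
    noncomm_ring
  rw [e]
  calc _ ≤ ‖(rowInLin (corrE R kz V) c - lineIn (n := n) R kz c.dir (wlogZ V c.src)) +
          (conjM (V c) (rowOutLin (corrE R kz V) c) - lineOut (n := n) R kz c.dir (wlogZ V c.src))‖ * ‖Vc‖ := norm_mul_le _ _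
    _ ≤ ((P.L : ℝ) * (K₁ * (2 * δ)) ^ 2 + ((P.L : ℝ) * (K₁ * (2 * δ)) ^ 2 + (P.L : ℝ) * (K₁ * unifB P R δ))) * 1 :=
        mul_le_mul ((norm_add_le _ _).trans (add_le_add hin hout)) (norm_coe_su_le_one₆ _) (norm_nonneg _)
          ((norm_nonneg _).trans ((norm_add_le _ _).trans (add_le_add hin hout)))
    _ = lineErr P R K₁ δ := by unfold lineErr; ring

/-- Hence for a LINE-NEUTRAL table the line functional is `O(δ²)`: `‖rowInLin E c·V(c) + V(c)·rowOutLin E c‖ ≤ lineErr P R K₁ δ`. -/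
theorem norm_line_corrE_le_of_lineNeutral (hj : j + 1 ≤ P.m + P.K) (hN : LineNeutral (n := n) R kz) (hδ0 : 0 ≤ δ)
    (hV : PlaqSmall δ V) (hδ : δ ≤ 1 / 3) (hπ : Fintype.card n * δ < Real.pi) (hK : RowMass R kz K₁) (hs1 : K₁ * (2 * δ) ≤ 1)
    (c : PBond P (j + 1)) :
    ‖rowInLin (corrE R kz V) c * ((V c : Matrix.specialUnitaryGroup n ℂ) : Matrix n n ℂ) +
        ((V c : Matrix.specialUnitaryGroup n ℂ) : Matrix n n ℂ) * rowOutLin (corrE R kz V) c‖ ≤ lineErr P R K₁ δ := by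
  have h := norm_line_corrE_sub_lineForm_le hj hδ0 hV hδ hπ hK hs1 c
  rwa [hN c.dir (wlogZ V c.src), zero_mul, sub_zero] at h

end Line

/-! ## §4 `ApproxLiftStep` from a line-neutral table (`SU(2)`) -/

section Step

variable {R : ℕ} {kz : Fin P.d → (Fin P.d → Fin P.L) → Orient P.d → (Fin P.d → Fin (2 * R + 1)) → ℝ}

/-- **`ApproxLiftStep` FROM A LINE-NEUTRAL KERNEL TABLE** (`SU(2)`, printed `exp[mean log]`, standing range): a table of row mass `≤ K₁` whose
LINE FORM vanishes (`LineNeutral`; no face support assumed), together with the plaquette clause `PlaqSmall (κ₀δ) (kernelLift R kz V)` on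
`δ`-small `V` and the smallness `320·(d+3)L·K₁·δ ≤ 1`, `δ ≤ 1/3`, gives
`ApproxLiftStep P j κ₀ ((477·(4(d+3)L·K₁)² + L(8K₁² + K₁(4 + dR + d(R+1))²))·δ²) δ` — the interior-supported twin of `mdist_avgFun_kernelLift_le`. -/
theorem approxLiftStep_of_lineNeutral (hj : j + 1 ≤ P.m + P.K) {K₁ κ₀ δ : ℝ} (hK : RowMass R kz K₁)
    (hN : LineNeutral (n := Fin 2) R kz) (hδ0 : 0 ≤ δ) (hδ : δ ≤ 1 / 3) (hsm : 320 * (legLen P : ℝ) * K₁ * δ ≤ 1)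
    (hplaq : ∀ V : GaugeField P (j + 1) (Matrix.specialUnitaryGroup (Fin 2) ℂ), PlaqSmall δ V → PlaqSmall (κ₀ * δ) (kernelLift R kz V)) :
    ApproxLiftStep P j κ₀
      ((477 * (4 * (legLen P : ℝ) * K₁) ^ 2 +
        (P.L : ℝ) * (8 * K₁ ^ 2 + K₁ * (((4 + P.d * R + P.d * (R + 1) : ℕ) : ℝ) ^ 2))) * δ ^ 2) δ := by
  have m1 : (1 : ℝ) ≤ legLen P := by
    have : 1 ≤ legLen P := le_trans P.L_pos (Nat.le_mul_of_pos_left _ (by omega))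
    exact_mod_cast this
  have hK0 : 0 ≤ K₁ :=
    le_trans (Finset.sum_nonneg fun o _ => Finset.sum_nonneg fun k _ => abs_nonneg _) (hK ⟨0, P.hd⟩ (fun _ => ⟨0, P.L_pos⟩))
  have hs1 : K₁ * (2 * δ) ≤ 1 := by nlinarith [mul_nonneg hK0 hδ0]
  have hπ : Fintype.card (Fin 2) * δ < Real.pi := by rw [Fintype.card_fin]; push_cast; nlinarith [Real.pi_gt_three]
  -- the correction recipe and its three properties
  have hE : ∀ V : GaugeField P (j + 1) (Matrix.specialUnitaryGroup (Fin 2) ℂ), PlaqSmall δ V →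
      ∀ b, dist1 (corrE R kz V b) ≤ 2 * (K₁ * (2 * δ)) := fun V hV b =>
    dist1_corrE_le hV hδ hπ (norm_zeta_le hδ0 hV (hδ.trans (by norm_num)) hK b) hs1
  have hsm' : 80 * (legLen P : ℝ) * (2 * (K₁ * (2 * δ))) ≤ 1 := by nlinarith
  have hline : ∀ V : GaugeField P (j + 1) (Matrix.specialUnitaryGroup (Fin 2) ℂ), PlaqSmall δ V → ∀ c : PBond P (j + 1),
      ‖rowInLin (corrE R kz V) c * ((V c : Matrix.specialUnitaryGroup (Fin 2) ℂ) : Matrix (Fin 2) (Fin 2) ℂ) +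
          ((V c : Matrix.specialUnitaryGroup (Fin 2) ℂ) : Matrix (Fin 2) (Fin 2) ℂ) * rowOutLin (corrE R kz V) c‖ ≤ lineErr P R K₁ δ :=
    fun V hV c => norm_line_corrE_le_of_lineNeutral hj hN hδ0 hV hδ hπ hK hs1 c
  have h := approxLiftStep_of_legs hj (fun V => corrE R kz V) hplaq hE hsm' hline
  -- rewrite the accuracy constant
  have heq : 477 * ((legLen P : ℝ) * (2 * (K₁ * (2 * δ)))) ^ 2 + lineErr P R K₁ δ =
      (477 * (4 * (legLen P : ℝ) * K₁) ^ 2 +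
        (P.L : ℝ) * (8 * K₁ ^ 2 + K₁ * (((4 + P.d * R + P.d * (R + 1) : ℕ) : ℝ) ^ 2))) * δ ^ 2 := by
    unfold lineErr unifB; ring
  rw [← heq]
  exact h

end Step

end Summit.QuantumFields.YangMills.Theorems.ApproxLift

end
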